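import Mathlib
import Summits.NavierStokesRegularity.NavierStokesRegularity.Theses.FilamentSkeletonRss
import Literature.Analysis.FluidPDE.GaussianVortexPlanar

/-!
# Crux `CoreGluingGivenInvertibilityQR` (stmt-NavierStokesRegularity-19176) — line `Sketch`, skeleton v1

`CoreGluingGivenInvertibilityQR := CoreLinearInvertibility → TransverseReductionR` (route FilamentSkeletonRss,
rev 9).  `CoreLinearInvertibility` is a tree theorem (`Theorems.coreLinearInvertibility_proof`), so the crux is
`TransverseReductionR`: the nonlinear gluing of strained Gaussian cores onto a tilted, parameter-bounded skeleton
box, modulo rotation about `e₃` and the `N` accretion modes.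

Line `Sketch` = crux-ideate r1 ideator-1 (cards `group-velocity-dichotomy`, `tangent-model-liouville`), with
ideator-2's exact identities (`frame-pump-sonic-trap`, `tilted-core-rotation-shift`) as tools.  Composition:

* `stub_qrHelicalRadiationInverse` — radiation (inward) inverse of the neutral `m = ±1` end sector
  `i c η′ − w η = f` with the condition at the far end (complement of `stub_inviscidEndHasNeutralMode`);
* `stub_qrDampedSectorBound` — two-sided maximum principle for a damped swept sector, no end condition;
* `stub_qrAmbientRotationSkew` — the tilt term `−ω∂_θ` is skew in every radial Gaussian weight `G_λ`;
* `stub_qrAxisHeadIdentity` — exact rotating-frame Bernoulli law of the TR_R profile equation;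
* `stub_qrHydraulicLaw` — the quasi-one-dimensional hydraulic law of a slender core end (pointwise calculus);
* `stub_qrClosure` — THE CRUX-SIZED STEP (held by the lead): sector-by-sector two-sided tube inverse
  (dichotomies in arclength, end conditions by group velocity, index paid by rotation + the `N` accretion
  scalars) and the contraction at residual `O(Γ^{-1/2})`, producing TR_R's reduced family `(U, P, B)` from
  `CoreLinearInvertibility` and the tools above.

`CoreGluingGivenInvertibilityQR_of` concludes the crux BY NAME from the six stubs.
-/

set_option linter.dupNamespace false

noncomputable section

namespace Summit.NavierStokesRegularity.NavierStokesRegularity.Theorems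

open MeasureTheory Real Set Filter Topology
open scoped InnerProductSpace
open Literature.Analysis.FluidPDE
open Summit.NavierStokesRegularity.NavierStokesRegularity.Theses.FilamentSkeletonRss

/-- **Stub (m = ±1 end sector, radiation inverse).** For `c ≠ 0`, continuous `w` and continuous integrable
forcing `f`, the end equation `i c η′ − w η = f` has a differentiable solution with the far-end bound
`‖η(τ)‖ ≤ |c|⁻¹ ∫_{(τ,∞)} ‖f‖`, unique among differentiable solutions tending to `0` at `+∞`
(integrating factor `e^{−iW/c}`, `W = ∫₀ w`). [folklore] -/
theorem stub_qrHelicalRadiationInverse :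
    ∀ (c : ℝ) (w : ℝ → ℝ) (f : ℝ → ℂ), c ≠ 0 → Continuous w → Continuous f →
      Integrable (fun s => ‖f s‖) →
      ∃ η : ℝ → ℂ, Differentiable ℝ η ∧
        (∀ τ, (c : ℂ) * Complex.I * deriv η τ - (w τ : ℂ) * η τ = f τ) ∧
        (∀ τ, ‖η τ‖ ≤ |c|⁻¹ * ∫ s in Set.Ioi τ, ‖f s‖) ∧
        ∀ η₂ : ℝ → ℂ, Differentiable ℝ η₂ →
          (∀ τ, (c : ℂ) * Complex.I * deriv η₂ τ - (w τ : ℂ) * η₂ τ = f τ) →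
          Tendsto η₂ atTop (𝓝 0) → η₂ = η := by
  sorry

/-- **Stub (damped swept sector, two-sided bound).** A bounded `C²` solution of `−η″ + w η′ + a η = f` on `ℝ`
with damping `a ≥ a₀ > 0`, sweep of at most linear growth and bounded forcing obeys `a₀ |η| ≤ sup |f|`,
with no condition at either end (maximum principle with the barrier `ε log(1+τ²)`). [folklore] -/
theorem stub_qrDampedSectorBound :
    ∀ (a₀ C F : ℝ) (w a η f : ℝ → ℝ), 0 < a₀ → (∀ τ, a₀ ≤ a τ) → (∀ τ, |w τ| ≤ C * (1 + |τ|)) →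
      (∀ τ, |f τ| ≤ F) → ContDiff ℝ 2 η → (∃ B, ∀ τ, |η τ| ≤ B) →
      (∀ τ, -(deriv (deriv η) τ) + w τ * deriv η τ + a τ * η τ = f τ) →
      ∀ τ, a₀ * |η τ| ≤ F := by
  sorry

/-- **Stub (ambient rotation is skew in the radial weight).** For `λ < 1` and a `C¹` planar vorticity `w` with
`G_λ⁻¹ w²` and `G_λ⁻¹ |x| |w| |∇w|` integrable, `∫ G_λ⁻¹ w ∂_θ w = 0` (`∂_θ = x₀∂₁ − x₁∂₀`; `G_λ = gaussWeightLam λ`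
is radial, so `G_λ⁻¹ w ∂_θ w = ½ ∂_θ(G_λ⁻¹ w²)` integrates to zero over every circle). [folklore] -/
theorem stub_qrAmbientRotationSkew :
    ∀ (lam : ℝ) (w : EuclideanSpace ℝ (Fin 2) → ℝ), lam < 1 → ContDiff ℝ 1 w →
      Integrable (fun x => (gaussWeightLam lam x)⁻¹ * w x ^ 2) →
      Integrable (fun x => (gaussWeightLam lam x)⁻¹ * (‖x‖ * (|w x| * ‖gradient w x‖))) →
      ∫ x, (gaussWeightLam lam x)⁻¹ *
          (w x * (x 0 * fderiv ℝ w x (EuclideanSpace.single 1 1) -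
            x 1 * fderiv ℝ w x (EuclideanSpace.single 0 1))) = 0 := by
  sorry

/-- **Stub (axis head identity = rotating-frame Bernoulli law of the TR_R profile equation).** If `(U, P)` solve
`α(e₃×U − DU[e₃×y]) + ½U + ½DU[y] − ΔU + DU[U] + ∇P = F`, then with the frame velocity `W = U + ½y − α e₃×y`
and the head `H = ½|W|² + P − |y|²/8 − ½α²(y₀² + y₁²)` one has pointwise `⟪W, ∇H⟫ = ⟪W, ΔU + F⟫`
(the equation is `W·∇W + 2α e₃×W + ∇(P − |y|²/8 − ½α²|y_h|²) = ΔU + F` and the Coriolis force does no work).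
[folklore] -/
theorem stub_qrAxisHeadIdentity :
    ∀ (α : ℝ) (U F : EuclideanSpace ℝ (Fin 3) → EuclideanSpace ℝ (Fin 3)) (P : EuclideanSpace ℝ (Fin 3) → ℝ),
      ContDiff ℝ 2 U → ContDiff ℝ 1 P →
      (∀ y, α • (cross (EuclideanSpace.single 2 1) (U y) - fderiv ℝ U y (cross (EuclideanSpace.single 2 1) y))
          + (1/2 : ℝ) • U y + (1/2 : ℝ) • fderiv ℝ U y y - (Laplacian.laplacian U) y + fderiv ℝ U y (U y)
          + gradient P y = F y) →
      ∀ y, ⟪U y + (1/2 : ℝ) • y - α • cross (EuclideanSpace.single 2 1) y,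
            gradient (fun z => (1/2 : ℝ) * ‖U z + (1/2 : ℝ) • z - α • cross (EuclideanSpace.single 2 1) z‖ ^ 2
              + P z - ‖z‖ ^ 2 / 8 - (1/2 : ℝ) * α ^ 2 * (z 0 ^ 2 + z 1 ^ 2)) y⟫_ℝ
          = ⟪U y + (1/2 : ℝ) • y - α • cross (EuclideanSpace.single 2 1) y,
              (Laplacian.laplacian U) y + F y⟫_ℝ := by
  sorry

/-- **Stub (hydraulic law of a slender core end).** From the volume budget `(A V)′ = (3/2)A + 4` and the axis head
law `Cκ² (1/A)′ = V V′ − w w′` at a point where `A, V ≠ 0`: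
`(Cκ²/A − V²) V′ = (Cκ²/A)(3/2 + 4/A) − V (w w′)`. [folklore] -/
theorem stub_qrHydraulicLaw :
    ∀ (Cκ2 : ℝ) (V A w : ℝ → ℝ) (τ : ℝ), DifferentiableAt ℝ V τ → DifferentiableAt ℝ A τ →
      DifferentiableAt ℝ w τ → A τ ≠ 0 → V τ ≠ 0 →
      deriv (fun s => A s * V s) τ = 3/2 * A τ + 4 →
      Cκ2 * deriv (fun s => (A s)⁻¹) τ = V τ * deriv V τ - w τ * deriv w τ →
      (Cκ2 / A τ - V τ ^ 2) * deriv V τ = Cκ2 / A τ * (3/2 + 4 / A τ) - V τ * (w τ * deriv w τ) := by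
  sorry

/-- **Stub (closure — the crux-sized step, held by the lead).** Given the planar core inverse bound
(`CoreLinearInvertibility`), the radiation inverse of the `m = ±1` end sector, the two-sided bound of the damped
sectors, the skewness of the tilt term in the radial weight, the exact head identity and the hydraulic law, build the
two-sided inverse of the linearised dressed-tube operator of every admissible box (dichotomies in arclength, end
conditions placed by group velocity, index paid by rotation about `e₃` and the `N` accretion scalars) and close the
contraction at residual `O(Γ^{-1/2})`: `TransverseReductionR`. [conjecture] -/
theorem stub_qrClosure :
    (∀ (c : ℝ) (w : ℝ → ℝ) (f : ℝ → ℂ), c ≠ 0 → Continuous w → Continuous f →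
      Integrable (fun s => ‖f s‖) →
      ∃ η : ℝ → ℂ, Differentiable ℝ η ∧
        (∀ τ, (c : ℂ) * Complex.I * deriv η τ - (w τ : ℂ) * η τ = f τ) ∧
        (∀ τ, ‖η τ‖ ≤ |c|⁻¹ * ∫ s in Set.Ioi τ, ‖f s‖) ∧
        ∀ η₂ : ℝ → ℂ, Differentiable ℝ η₂ →
          (∀ τ, (c : ℂ) * Complex.I * deriv η₂ τ - (w τ : ℂ) * η₂ τ = f τ) →
          Tendsto η₂ atTop (𝓝 0) → η₂ = η) →
    (∀ (a₀ C F : ℝ) (w a η f : ℝ → ℝ), 0 < a₀ → (∀ τ, a₀ ≤ a τ) → (∀ τ, |w τ| ≤ C * (1 + |τ|)) →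
      (∀ τ, |f τ| ≤ F) → ContDiff ℝ 2 η → (∃ B, ∀ τ, |η τ| ≤ B) →
      (∀ τ, -(deriv (deriv η) τ) + w τ * deriv η τ + a τ * η τ = f τ) →
      ∀ τ, a₀ * |η τ| ≤ F) →
    (∀ (lam : ℝ) (w : EuclideanSpace ℝ (Fin 2) → ℝ), lam < 1 → ContDiff ℝ 1 w →
      Integrable (fun x => (gaussWeightLam lam x)⁻¹ * w x ^ 2) →
      Integrable (fun x => (gaussWeightLam lam x)⁻¹ * (‖x‖ * (|w x| * ‖gradient w x‖))) →
      ∫ x, (gaussWeightLam lam x)⁻¹ *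
          (w x * (x 0 * fderiv ℝ w x (EuclideanSpace.single 1 1) -
            x 1 * fderiv ℝ w x (EuclideanSpace.single 0 1))) = 0) →
    (∀ (α : ℝ) (U F : EuclideanSpace ℝ (Fin 3) → EuclideanSpace ℝ (Fin 3)) (P : EuclideanSpace ℝ (Fin 3) → ℝ),
      ContDiff ℝ 2 U → ContDiff ℝ 1 P →
      (∀ y, α • (cross (EuclideanSpace.single 2 1) (U y) - fderiv ℝ U y (cross (EuclideanSpace.single 2 1) y))
          + (1/2 : ℝ) • U y + (1/2 : ℝ) • fderiv ℝ U y y - (Laplacian.laplacian U) y + fderiv ℝ U y (U y)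
          + gradient P y = F y) →
      ∀ y, ⟪U y + (1/2 : ℝ) • y - α • cross (EuclideanSpace.single 2 1) y,
            gradient (fun z => (1/2 : ℝ) * ‖U z + (1/2 : ℝ) • z - α • cross (EuclideanSpace.single 2 1) z‖ ^ 2
              + P z - ‖z‖ ^ 2 / 8 - (1/2 : ℝ) * α ^ 2 * (z 0 ^ 2 + z 1 ^ 2)) y⟫_ℝ
          = ⟪U y + (1/2 : ℝ) • y - α • cross (EuclideanSpace.single 2 1) y,
              (Laplacian.laplacian U) y + F y⟫_ℝ) →
    (∀ (Cκ2 : ℝ) (V A w : ℝ → ℝ) (τ : ℝ), DifferentiableAt ℝ V τ → DifferentiableAt ℝ A τ →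
      DifferentiableAt ℝ w τ → A τ ≠ 0 → V τ ≠ 0 →
      deriv (fun s => A s * V s) τ = 3/2 * A τ + 4 →
      Cκ2 * deriv (fun s => (A s)⁻¹) τ = V τ * deriv V τ - w τ * deriv w τ →
      (Cκ2 / A τ - V τ ^ 2) * deriv V τ = Cκ2 / A τ * (3/2 + 4 / A τ) - V τ * (w τ * deriv w τ)) →
    CoreLinearInvertibility → TransverseReductionR := by
  sorry

/-- **Composition.** The crux `CoreGluingGivenInvertibilityQR = (CoreLinearInvertibility → TransverseReductionR)`
BY NAME, from the six registered stubs of line `Sketch`. -/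
theorem CoreGluingGivenInvertibilityQR_of : CoreGluingGivenInvertibilityQR :=
  fun hL => stub_qrClosure stub_qrHelicalRadiationInverse stub_qrDampedSectorBound stub_qrAmbientRotationSkew
    stub_qrAxisHeadIdentity stub_qrHydraulicLaw hL

end Summit.NavierStokesRegularity.NavierStokesRegularity.Theorems
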